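import Summits.QuantumFields.BalabanUV.Beta.EriceRemainderEnclosureHistoryAutonomyComparisonAgeComposition

/-!
# EriceRemainderEnclosureHistoryAutonomyComparisonAgeCompositionSandwich — (E71d) THE SURPLUS SANDWICH AND THE STATIC CHAIN: when the young age is added
# (route (N), (E71a)–(E71c)), the full surplus is sandwiched by the old one, `(1 − ρ)·v_O ≤ ε ≤ v_O` (`ρ` = the KEY ratio), so every old age's
# drop-to-surplus ratio is divided by `1 − ρ` and the young age enters with ratio `ρ∕(1−ρ)` — the induction over the ages becomes a STATIC recursion over
# flow quantities (damped loads, window masses, persistence defects) whose closure `ρ < 1` is, on every flow computed, attained at a LONE age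

Cell `pub-balaban`, β-function sub-cell, BINDER row D4 «RemainderConst leaves for Bałaban's split» (`HOME/BINDER-OWNERS.md`; owner lineage `b2b-balaban-beta-an4`;
this file by co-owner #2 lineage `b2b-balaban-beta-d4-p2`, generation 62), β-FLOW TEAM duty (1), FREEZE (0) honoured (def-free; (E71a)'s `nonneg_of_age_composition`,
`sol_nonneg_le_of_supersol`, `sol_unique`, `read_le_read`, `read_eq_zero_of_tail` BY NAME; nothing restated).

HONEST FRAMING (page 1, verbatim and binding).  *"Discharging BetaPertH makes Bałaban's UV stability UNCONDITIONAL — a real constructive-QFT result; it is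
NOT the continuum limit and NOT the Clay problem."*  THIS FILE DISCHARGES NOTHING OF THE KIND.  Elementary linear algebra about ABSTRACT real sequences and
triangular systems — hypotheses of a census, not facts; the form, signs, ages and moments of Bałaban's (1.22) limit functional are NOT PRINTED ([I] p. 298;
GAPS G-t4-U2-1∕-2) and NOT asserted.  Row D4 class UNCHANGED (critical-path width 0; instance 0∕1; D4 DISCHARGE NO DATE).  HONEST DEPENDENCY: continuum YM on
T⁴ ⇐ BetaPertH ∧ nine spine estimates (0/9 proved); BetaPertH ⇐ (D1) ∧ (D4) ∧ CAP+tail; G-an2-4 gates asym, D1 and NE2/3/4.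

THE POINT (census sense (α); the COMPARISON column, conjecture (E58′), route (N) of `HOME/b2b-balaban-beta-d4-p2/g62/e71/README.md` §PS).  (E71c) reduces KEY
at a pin to `x̃·(1 + S∕v) ≤ 1 − Ω` where the Harnack load per unit surplus `S∕v = Σ_{k∈O} θ̂_k·(d_k∕v)` needs the DROP-TO-SURPLUS RATIOS `β_k ≥ d_k∕v` of
the older ages — quantities the induction over the ages must CARRY.  §1 **`surplus_sandwich`**: if the old outputs satisfy KEY with the ratio `ρ`
(`R_y v_O ≤ ρ·v_O`) and the young drops of the full surplus are admissible (MONO′), then `(1−ρ_n)·v_O(n) ≤ ε(n) ≤ v_O(n)` — lower from (E71a)'s bound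
`ε ≥ R_y v_O ≥ v_O − K_y v_O`, upper because `ε + S_O(K_y ε)` solves the old system with input `e` and so equals `v_O` by uniqueness.  §1 `drop_ratio_step`:
hence every monotone drop functional has its ratio transported as `β ↦ β∕(1−ρ)`, and the young age's own drop obeys `d_y ≤ x̃·max_window ε ≤ x̃·H·v_O ≤
(ρ∕(1−ρ))·ε`.  THE STATIC CHAIN (README §PS): at each pin `m`, process the ages OLDEST TO YOUNGEST with `S = Σ_{k older} θ̂_k(m;y)·β_k`, `Ω` = older mass
inside the young window, `H = (1+S)∕(1−Ω)`, `ρ = x̃_y(m)·H`; require `ρ < 1`; update `β_k ↦ β_k∕(1−ρ)`, `β_y := ρ∕(1−ρ)`.  Modulo MONO∕MONO′ this recursion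
over FLOW QUANTITIES ONLY (no triangular solves) implies KEY at every age, hence the first-order (E58′) by (E71b).  NUMERICS of record (`g62/numerics/t17.py`,
`t18.py`; adversarial coupling ratios; towers R = 2…16, Fibonacci, clusters, 2–8 ages; every pin): the static chain's `ρ` is ≤ 0.549 with its SUPREMUM AT A
LONE SATURATED AGE (`S = Ω = 0`, `ρ = x̃`); the interaction part `ρ − x̃` is ≤ 0.07, `S ≤ 0.37`, `Ω ≤ 0.20`, `β ≤ 0.52`.  So the remaining analytic task of
route (N) is a STATIC inequality about flows: «the static chain closes», whose mechanism is (E65a)'s window budget (uniform octave loads ≤ 0.115 make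
`Σ_t (y∕k_t)·β_t` geometric — README).  NOT CLAIMED: the static chain's closure for the flow; MONO; (E58′); anything nonlinear; anything printed.

WHAT IS PROVED ([folklore]; 0 `def`, 0 sorry).  §1 `read_add_fun`, **`surplus_sandwich`** (`(1−ρ)·S_O e ≤ ε ≤ S_O e`), **`drop_ratio_step`** (`β ↦ β∕(1−ρ)`).
-/
noncomputable section
open Finset

namespace Summit.QuantumFields.BalabanUV.Beta.EriceRemainderEnclosureHistoryAutonomyComparisonAgeCompositionSandwich

open Summit.QuantumFields.BalabanUV.Beta.EriceRemainderEnclosureHistoryAutonomyComparisonAgeComposition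

variable {N : ℕ} {KO Ky : ℕ → ℕ → ℝ} {RO Ry SO Sy : (ℕ → ℝ) → ℕ → ℝ}

/-- Reads are additive. [folklore] -/
theorem read_add_fun {K : ℕ → ℕ → ℝ} {R : (ℕ → ℝ) → ℕ → ℝ} (hR : ∀ v n, R v n = ∑ l ∈ range N, K n l * v (n + 1 + l))
    (u v : ℕ → ℝ) (n : ℕ) : R (fun m => u m + v m) n = R u n + R v n := by
  rw [hR, hR, hR, ← sum_add_distrib]
  exact sum_congr rfl fun l _ => by ring

/-- **THE SURPLUS SANDWICH (one level of route (N)'s static chain).**  In the setting of (E71a) `nonneg_of_age_composition` (old kernel `KO` with read `RO`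
and zero-tailed solution operator `SO`, young NON-NEGATIVE kernel `Ky` with `Ry`, `Sy`; an input class `A ∋ e` on which the old solutions are non-negative
supersolutions of the young kernel and which is stable under `RO ∘ Ry ∘ Sy ∘ SO`), suppose moreover that KEY holds WITH A RATIO: `Ry (SO e) ≤ ρ·SO e`
pointwise, and that the young drops `Ry ε` of the full solution `ε` are again an admissible input (MONO′).  Then the full surplus is SANDWICHED by the
old one: **`(1 − ρ_n)·(SO e) n ≤ ε n ≤ (SO e) n`** at every depth.  Lower: `ε ≥ Sy (SO e) = SO e − Ry (Sy (SO e)) ≥ SO e − Ry (SO e)`; upper: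
`ε + SO (Ry ε)` solves the old system with input `e`, so it IS `SO e` by uniqueness, and `SO (Ry ε) ≥ 0`.  Consequence (docstring of the file): every
monotone drop functional `D ≥ 0` has `D ε ≤ D (SO e) ≤ β·(SO e) ≤ (β∕(1−ρ))·ε` — the drop-to-surplus ratios of the old ages are divided by `1 − ρ` when
the young age is added, and the young age's own ratio is `≤ ρ∕(1−ρ)`: the STATIC CHAIN. [folklore] -/
theorem surplus_sandwich
    (hRO : ∀ v n, RO v n = ∑ l ∈ range N, KO n l * v (n + 1 + l))
    (hRy : ∀ v n, Ry v n = ∑ l ∈ range N, Ky n l * v (n + 1 + l)) (hKy : ∀ n l, 0 ≤ Ky n l)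
    (hSO : ∀ w : ℕ → ℝ, (∀ n, N < n → w n = 0) → (∀ n, N < n → SO w n = 0) ∧ ∀ n, SO w n = w n - RO (SO w) n)
    (hSy : ∀ w : ℕ → ℝ, (∀ n, N < n → w n = 0) → (∀ n, N < n → Sy w n = 0) ∧ ∀ n, Sy w n = w n - Ry (Sy w) n)
    {A : (ℕ → ℝ) → Prop} {e : ℕ → ℝ} (he : ∀ n, N < n → e n = 0) (hAe : A e)
    (hA : ∀ w : ℕ → ℝ, A w → (∀ n, N < n → w n = 0) →
      (∀ n, 0 ≤ SO w n) ∧ (∀ n, Ry (SO w) n ≤ SO w n) ∧ A (RO (Ry (Sy (SO w)))))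
    {ε : ℕ → ℝ} (hεtail : ∀ n, N < n → ε n = 0) (hεrec : ∀ n, ε n = e n - RO ε n - Ry ε n)
    {ρ : ℕ → ℝ} (hρ : ∀ n, Ry (SO e) n ≤ ρ n * SO e n) (hMONO' : A (Ry ε)) :
    ∀ n, (1 - ρ n) * SO e n ≤ ε n ∧ ε n ≤ SO e n := by
  have hcomp := nonneg_of_age_composition hRO hRy hKy hSO hSy he hAe hA hεtail hεrec
  obtain ⟨hV0, hVsup, _⟩ := hA e hAe he
  have hVt := (hSO e he).1
  have hT := sol_nonneg_le_of_supersol hRy hKy hV0 hVsup (hSy _ hVt).1 (hSy _ hVt).2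
  intro n
  constructor
  · -- lower bound
    have h1 : Sy (SO e) n ≤ ε n := (hcomp n).2
    have h2 : Sy (SO e) n = SO e n - Ry (Sy (SO e)) n := (hSy _ hVt).2 n
    have h3 : Ry (Sy (SO e)) n ≤ Ry (SO e) n := read_le_read hRy hKy fun m _ => (hT m).2
    nlinarith [hρ n]
  · -- upper bound: ε + SO (Ry ε) = SO e
    have hut : ∀ m, N < m → Ry ε m = 0 := fun m hm =>
      read_eq_zero_of_tail (c := 0) hRy (fun k hk => hεtail k (by simpa using hk)) m (by omega)
    obtain ⟨hx0, _, _⟩ := hA (Ry ε) hMONO' hut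
    have hxt := (hSO (Ry ε) hut).1
    have hxrec := (hSO (Ry ε) hut).2
    have hsum_tail : ∀ m, N < m → (fun k => ε k + SO (Ry ε) k) m = 0 := fun m hm => by
      simp only [hεtail m hm, hxt m hm, add_zero]
    have hsum_rec : ∀ m, (fun k => ε k + SO (Ry ε) k) m = e m - RO (fun k => ε k + SO (Ry ε) k) m := fun m => by
      simp only [read_add_fun hRO]
      linarith [hεrec m, hxrec m]
    have huniq : ε n + SO (Ry ε) n = SO e n := sol_unique hRO hsum_tail hsum_rec hVt (hSO e he).2 n
    linarith [hx0 n]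

/-- **THE STATIC CHAIN STEP FOR DROP RATIOS.**  Under the sandwich, any non-negative functional `D` that is monotone on non-negative sequences
(`0 ≤ u ≤ v ⟹ D u ≤ D v`, e.g. an age's drop at a pin) and bounded on the old surplus by `D (SO e) ≤ β·(SO e) n` at a depth `n` with `ρ_n < 1`, is bounded
on the full surplus by `D ε ≤ (β∕(1−ρ_n))·ε n`. [folklore] -/
theorem drop_ratio_step {D : (ℕ → ℝ) → ℝ} (hDmono : ∀ u v : ℕ → ℝ, (∀ m, 0 ≤ u m) → (∀ m, u m ≤ v m) → D u ≤ D v)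
    {ε v : ℕ → ℝ} {n : ℕ} {ρ β : ℝ} (hε0 : ∀ m, 0 ≤ ε m) (hle : ∀ m, ε m ≤ v m) (hlow : (1 - ρ) * v n ≤ ε n) (hρ : ρ < 1) (hβ : 0 ≤ β)
    (hD : D v ≤ β * v n) : D ε ≤ β / (1 - ρ) * ε n := by
  have h1 : D ε ≤ β * v n := (hDmono ε v hε0 hle).trans hD
  have h2 : v n ≤ ε n / (1 - ρ) := by rw [le_div_iff₀ (by linarith)]; linarith
  calc D ε ≤ β * v n := h1
    _ ≤ β * (ε n / (1 - ρ)) := mul_le_mul_of_nonneg_left h2 hβ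
    _ = β / (1 - ρ) * ε n := by ring

end Summit.QuantumFields.BalabanUV.Beta.EriceRemainderEnclosureHistoryAutonomyComparisonAgeCompositionSandwich

end
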